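/-
COR-CM (cell pub-hodgecm2, stage 2 of the Hodge ladder) — TRANSPOSITION SURGE, dictionary item (i) «SETTING» of rfwf v3 §4.2:
the DISCHARGE of the typed axiom `Transposition.Item1Setting` (`Transposition/Item1Setting.lean`, typer prover-pub-hodgecm2-tr-typer-1-0,
gate p273193).  AUTHORED AND FILED by the typer (single writer per lead gen 6 ruling HOME/INBOX l.3752 (2), 2026-08-21T13:01:58Z:
«tr-typer-1: YES — file `Transposition/Item1SettingHolds.lean` yourself … tr-prover-1 not needed»); farm-checked before filing as a
concatenation with `Assembly.lean` + `Item1Setting.lean` (`HOME/transposition/item-1/probe_holds2.lean`: rc 0 · 0 sorry · axioms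
[propext, Classical.choice, Quot.sound] on `faceThetaDataExists_of_forall`).  Theorems only; nothing asserted about periods.
FRAMING (COORDINATOR 2026-08-21T11:55:35Z): `HC_CM` is NOT proved.
-/
import Summits.HodgeConjecture.CorCM.B01.Transposition.Item1Setting
import Summits.HodgeConjecture.CorCM.B01.Transposition.Assembly
import HarnessLib

/-!
# Transposition, item (i) SETTING holds: `levelCofinal_holds`, `item1Setting_holds`

* `levelCofinal_holds` — a torsion-free congruence level inside every open subgroup `K'` of `U(V₃,h)(𝔸_{L₀,f})`: intersect ANY
  level `Γ₀` (`Level.nonempty`, `Geometry/NonVacuity.lean:97`: `(Γ(3), K_f(3𝓞_L))`, Minkowski 1887 / Platonov–Rapinchuk §4.1) with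
  `K'` — the pair `(U(L₀) ∩ (K₀ ∩ K'), K₀ ∩ K')` is a level (compact as a closed subset of `K₀`, open, torsion-free inside `Γ₀` by
  `UnitaryGroup.arithmeticLevel_mono`) and `K₀ ∩ K' ≤ K'`.  Degree-free, V-uniform.
* `item1Setting_holds : Transposition.Item1Setting` — with `StubTree.admissible_exists` and `landherr_exists_proof`
  (`item1Setting_of_levelCofinal`).  ITEM (i) IS DISCHARGED: tag VERBATIM confirmed in the kernel.
* `faceThetaDataExists_of_forall` — BY NAME: V-uniform face theta data at every admissible `(ι₁, V)` give
  `Universe.FaceThetaDataExists U` (`Transposition/Assembly.lean:52`), hypothesis-free in item (i)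
  (= `Universe.faceThetaDataExists_of_forall` :70 with `hadm`, `hV` discharged).

References: PerL v5 §1.2; [Y1neg] §1.1 / Lemma 7.2; H. Minkowski (1887); V. Platonov, A. Rapinchuk (1994) §4.1/§5.1.
-/

noncomputable section

namespace Summit.HodgeConjecture.CorCM

namespace Transposition

open NumberField
open Literature.AlgebraicGeometry.Motives (CMType)
open Literature.NumberTheory.Automorphic

/-- **`LevelCofinal` holds**: intersect any torsion-free congruence level `Γ₀` of `U(V₃,h)` (`Level.nonempty`,
`Geometry/NonVacuity.lean:97`) with the given open subgroup `K'`: the pair `(U(L₀) ∩ (K₀ ∩ K'), K₀ ∩ K')` is a level (compact: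
closed subset of the compact `K₀`; open; torsion-free as a subgroup of `Γ₀`, `UnitaryGroup.arithmeticLevel_mono`) with
`K₀ ∩ K' ≤ K'`. [folklore] -/
theorem levelCofinal_holds : LevelCofinal := by
  intro L ι₁ V K' hK'
  obtain ⟨Γ₀⟩ := Level.nonempty V
  refine ⟨{ Γ := UnitaryGroup.arithmeticLevel (↥(maximalRealSubfield L)) L (IsCMField.complexConj L) 3 V.Hm (Γ₀.K ⊓ K')
            K := Γ₀.K ⊓ K'
            isCompact_K := Γ₀.isCompact_K.inter_right (K'.isClosed_of_isOpen hK')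
            isOpen_K := Γ₀.isOpen_K.inter hK'
            arithmeticLevel_K := rfl
            torsionFree := fun γ hγ hfin => Γ₀.torsionFree γ ?_ hfin }, inf_le_right⟩
  have hmono := UnitaryGroup.arithmeticLevel_mono (F := ↥(maximalRealSubfield L)) (E := (L : Type))
    (c := IsCMField.complexConj L) (N := 3) (J := V.Hm) (inf_le_left : Γ₀.K ⊓ K' ≤ Γ₀.K)
  rw [Γ₀.arithmeticLevel_K] at hmono
  exact hmono hγ

/-- **Item (i) holds**: all three conjuncts of `Transposition.Item1Setting` are tree theorems
(`StubTree.admissible_exists`, `landherr_exists_proof`, `levelCofinal_holds`). [folklore] -/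
theorem item1Setting_holds : Item1Setting :=
  item1Setting_of_levelCofinal levelCofinal_holds

/-- **BY NAME**: V-uniform face theta data at every admissible `(ι₁, V)` give `Universe.FaceThetaDataExists U`
(`Transposition/Assembly.lean:52`) — the lead's `faceThetaDataExists_of_forall` (:70) with its two existence hypotheses
discharged by item (i); no hypothesis of item (i) remains on the path. [folklore] -/
theorem faceThetaDataExists_of_forall {U : Universe}
    (hR : ∀ (F : CMField), IsGalois ℚ F → 6 ≤ Module.finrank ℚ F → ∀ (f : Face F) (ι₁ : F →+* ℂ), f.Admissible ι₁ →
      ∀ V : HermSpace3 F ι₁, Nonempty (U.FaceThetaDatum ι₁ V F f.psi ι₁)) :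
    U.FaceThetaDataExists :=
  Universe.faceThetaDataExists_of_forall item1Setting_holds.admissibleExists
    (fun F ι₁ => item1Setting_holds.landherrExists F ι₁) hR

end Transposition

end Summit.HodgeConjecture.CorCM

end
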